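import Mathlib
import Literature.AlgebraicGeometry.Resolution.CobordantGame
import Literature.AlgebraicGeometry.Resolution.CobordantArcLemma
import Literature.AlgebraicGeometry.Resolution.FormalCoordinateChange
import Literature.AlgebraicGeometry.Resolution.FormalInverseFunction
import Summits.ResolutionOfSingularities.ResolutionOfSingularities.Theses.WeightedInvariant

/-!
# `WeightedInvariant.GlobalizeLocalDrop`, step (1) CANONIZE: the least game rank is a canonical,
# unit- and coordinate-invariant rank with the drop property

Route `ResolutionOfSingularities/WeightedInvariant`, support item `GlobalizeLocalDrop`
(stmt-ResolutionOfSingularities-14763): `LocalWeightedDrop → WeightedConstruction`.  The item's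
intended proof (its docstring) has three steps — (1) CANONIZE the arbitrary rank `ι` of the crux
`LocalWeightedDrop` into the GAME RANK `ρ(f)` = least ordinal admitting a move all of whose singular
successors have smaller `ρ`, "invariant under formal automorphisms and units, hence an invariant of the
complete local ring `k[[x]]/(f)`"; (2) EXTEND from hypersurface germs to pairs `X ⊆ Y`; (3) GLOBALIZE
(semicontinuity, gluing of centres, descent).  Steps (2)–(3) are not in print in characteristic `p`
(the item is conjecture-grade and closes realistically only with `WeightedConstruction` itself); this
file proves step (1) completely, in the vocabulary of `Literature.….CobordantGame`
(`Won`, `WonBy`, `leastRank`):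

* `localWeightedDrop_iff_allWon` — the crux is equivalent to: over every algebraically closed field of
  characteristic `p`, every singular germ lies in the inductive winning region `Won`;
  `leastRank_drop_of_localWeightedDrop` — under the crux, the CANONICAL rank `leastRank` (no choice
  involved) has the crux's drop property.
* `wonBy_subst_iff`, `leastRank_subst` — `WonBy α` and `leastRank` are invariant under formal
  coordinate changes `f ↦ f(φ)` (`φᵢ ∈ 𝔪`, invertible linear part): a move `(θ, w)` from `f(φ)` is the
  move `(φ ∘ θ, w)` from `f` with literally the same successors (`isSuccessor_subst_iff`), and `φ` has
  a compositional inverse (`FormalCoordChange.exists_comp_inverse`, in the tree).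
* `wonBy_unit_mul_iff`, `leastRank_unit_mul` — invariance under multiplication by units `u`
  (`u(0) ≠ 0`): the successors of `u · f` under `(θ, w)` are `U · (successors of f)` with `U` the
  (unit) transform of `u`, and singularity / `s`-saturation are insensitive to unit factors; transfinite
  induction on `α`.
* `leastRank_unit_mul_subst` — hence `leastRank (u · f(φ)) = leastRank f`: the game rank only depends
  on the ideal `(f) ⊆ k[[x₁,…,xₙ]]` up to formal coordinate change, as claimed in step (1).

Logical position of the item, for the record: `GlobalizeLocalDrop` is implied by either settlement
that is currently being attempted — a proof of the crux `WeightedConstruction` (its consequent) or a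
refutation of the crux `LocalWeightedDrop` (its antecedent); with `LocalWeightedDrop` proved it becomes
equivalent to `WeightedConstruction`.  Deliberately NOT here: steps (2) and (3) (no characteristic-`p`
tool exists in print; see the item's census on the ledger).
-/

set_option linter.dupNamespace false -- mandated namespace of this single-conjunct summit

namespace Summit.ResolutionOfSingularities.ResolutionOfSingularities.Theorems

open Literature.AlgebraicGeometry.Resolution
open Literature.AlgebraicGeometry.Resolution.CobordantGame
open Summit.ResolutionOfSingularities.ResolutionOfSingularities.Theses.WeightedInvariant

variable {k : Type} [Field k]

/-! ### 1. Substitutions: constant terms, linear parts, composition -/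

/-- A substitution by series without constant terms does not change the constant term. -/
theorem constantCoeff_subst_of_constantCoeff_zero {n : ℕ} {τ : Type*} (a : Fin n → MvPowerSeries τ k)
    (ha : ∀ i, MvPowerSeries.constantCoeff (a i) = 0) (u : MvPowerSeries (Fin n) k) :
    MvPowerSeries.constantCoeff (MvPowerSeries.subst a u) = MvPowerSeries.constantCoeff u := by
  have has := MvPowerSeries.hasSubst_of_constantCoeff_zero ha
  have hsplit : u = MvPowerSeries.C (MvPowerSeries.constantCoeff u) +
      (u - MvPowerSeries.C (MvPowerSeries.constantCoeff u)) := by ring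
  conv_lhs => rw [hsplit]
  rw [MvPowerSeries.subst_add has, MvPowerSeries.subst_C, map_add, MvPowerSeries.constantCoeff_C,
    MvPowerSeries.constantCoeff_subst_eq_zero has ha (by simp), add_zero]

/-- The components of a composite substitution `θ^*(φ i)` have zero constant terms. -/
theorem constantCoeff_comp_eq_zero {n : ℕ} {φ θ : Fin n → MvPowerSeries (Fin n) k}
    (hφ0 : ∀ i, MvPowerSeries.constantCoeff (φ i) = 0) (hθ0 : ∀ i, MvPowerSeries.constantCoeff (θ i) = 0)
    (i : Fin n) : MvPowerSeries.constantCoeff (MvPowerSeries.subst θ (φ i)) = 0 :=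
  MvPowerSeries.constantCoeff_subst_eq_zero (MvPowerSeries.hasSubst_of_constantCoeff_zero hθ0) hθ0 (hφ0 i)

/-- CHAIN RULE for linear parts: `linMat (θ^* ∘ φ) = linMat φ * linMat θ`. -/
theorem linMat_comp {n : ℕ} (φ : Fin n → MvPowerSeries (Fin n) k) {θ : Fin n → MvPowerSeries (Fin n) k}
    (hθ0 : ∀ i, MvPowerSeries.constantCoeff (θ i) = 0) :
    FormalCoordChange.linMat (fun i => MvPowerSeries.subst θ (φ i)) =
      FormalCoordChange.linMat φ * FormalCoordChange.linMat θ := by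
  ext i j
  simp only [FormalCoordChange.linMat, Matrix.of_apply, Matrix.mul_apply]
  exact CobordantArc.coeff_degree_one_subst θ hθ0 (φ i) _ (Finsupp.degree_single _ _)

/-- Composition of substitutions: `θ^*(φ^* f) = (θ^* ∘ φ)^* f`. -/
theorem subst_subst_eq_subst_comp {n : ℕ} {φ θ : Fin n → MvPowerSeries (Fin n) k}
    (hφ0 : ∀ i, MvPowerSeries.constantCoeff (φ i) = 0) (hθ0 : ∀ i, MvPowerSeries.constantCoeff (θ i) = 0)
    (f : MvPowerSeries (Fin n) k) :
    MvPowerSeries.subst θ (MvPowerSeries.subst φ f) =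
      MvPowerSeries.subst (fun i => MvPowerSeries.subst θ (φ i)) f :=
  MvPowerSeries.subst_comp_subst_apply (MvPowerSeries.hasSubst_of_constantCoeff_zero hφ0)
    (MvPowerSeries.hasSubst_of_constantCoeff_zero hθ0) f

/-- A compositional left inverse cancels: `ψ^*(φ^* f) = f` when `ψ^*(φ s) = x_s` for all `s`. -/
theorem subst_subst_of_comp_eq_X {n : ℕ} {φ ψ : Fin n → MvPowerSeries (Fin n) k}
    (hφ0 : ∀ i, MvPowerSeries.constantCoeff (φ i) = 0) (hψ0 : ∀ i, MvPowerSeries.constantCoeff (ψ i) = 0)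
    (hcomp : ∀ s, MvPowerSeries.subst ψ (φ s) = MvPowerSeries.X s) (f : MvPowerSeries (Fin n) k) :
    MvPowerSeries.subst ψ (MvPowerSeries.subst φ f) = f := by
  rw [subst_subst_eq_subst_comp hφ0 hψ0 f, show (fun s => MvPowerSeries.subst ψ (φ s)) = MvPowerSeries.X from
    funext hcomp, MvPowerSeries.subst_self]
  rfl

/-- The compositional inverse of a formal coordinate change has invertible linear part. -/
theorem isUnit_det_linMat_of_comp_eq_X {n : ℕ} {φ ψ : Fin n → MvPowerSeries (Fin n) k}
    (hψ0 : ∀ i, MvPowerSeries.constantCoeff (ψ i) = 0)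
    (hcomp : ∀ s, MvPowerSeries.subst ψ (φ s) = MvPowerSeries.X s) :
    IsUnit (FormalCoordChange.linMat ψ).det := by
  have h := congrArg Matrix.det (CobordantArc.linMat_mul_of_comp_eq_X hψ0 hcomp)
  rw [Matrix.det_mul, Matrix.det_one] at h
  exact IsUnit.of_mul_eq_one_right _ h

/-! ### 2. Moves and successors under a formal coordinate change -/

/-- A legal move `(θ, w)` composed with a formal coordinate change `φ` is a legal move `(θ^* ∘ φ, w)`. -/
theorem isMove_comp {n : ℕ} {φ θ : Fin n → MvPowerSeries (Fin n) k} {w : Fin n → ℕ}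
    (hφ0 : ∀ i, MvPowerSeries.constantCoeff (φ i) = 0) (hφdet : IsUnit (FormalCoordChange.linMat φ).det)
    (hm : IsMove k θ w) : IsMove k (fun i => MvPowerSeries.subst θ (φ i)) w := by
  obtain ⟨hθ0, hdet, hw⟩ := hm
  refine ⟨constantCoeff_comp_eq_zero hφ0 hθ0, ?_, hw⟩
  change IsUnit (FormalCoordChange.linMat (fun i => MvPowerSeries.subst θ (φ i))).det
  rw [linMat_comp φ hθ0, Matrix.det_mul]
  exact hφdet.mul hdet

/-- SAME SUCCESSORS: the successors of `φ^* f` under `(θ, w)` are exactly the successors of `f` under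
`(θ^* ∘ φ, w)` (the two transforms are the same series). -/
theorem isSuccessor_subst_iff {n : ℕ} {φ θ : Fin n → MvPowerSeries (Fin n) k} {w : Fin n → ℕ}
    (hφ0 : ∀ i, MvPowerSeries.constantCoeff (φ i) = 0) (hθ0 : ∀ i, MvPowerSeries.constantCoeff (θ i) = 0)
    (f : MvPowerSeries (Fin n) k) (g : MvPowerSeries (Fin (n + 1)) k) :
    IsSuccessor k (MvPowerSeries.subst φ f) θ w g ↔
      IsSuccessor k f (fun i => MvPowerSeries.subst θ (φ i)) w g := by
  simp only [IsSuccessor, subst_subst_eq_subst_comp hφ0 hθ0 f]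

/-- `WonBy α` transports back along a formal coordinate change: if `φ^* f` is won with value `≤ α`
then so is `f` (play `(θ^* ∘ φ, w)` instead of `(θ, w)`). -/
theorem wonBy_of_wonBy_subst {α : Ordinal.{0}} {n : ℕ} {φ : Fin n → MvPowerSeries (Fin n) k}
    (hφ0 : ∀ i, MvPowerSeries.constantCoeff (φ i) = 0) (hφdet : IsUnit (FormalCoordChange.linMat φ).det)
    {f : MvPowerSeries (Fin n) k} (h : WonBy k α n (MvPowerSeries.subst φ f)) : WonBy k α n f := by
  rw [wonBy_iff] at h ⊢
  obtain ⟨θ, w, hm, hs⟩ := h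
  refine ⟨fun i => MvPowerSeries.subst θ (φ i), w, isMove_comp hφ0 hφdet hm, fun g hg => hs g ?_⟩
  rwa [isSuccessor_subst_iff hφ0 hm.1 f g]

/-- COORDINATE INVARIANCE of the game values: `WonBy α (φ^* f) ↔ WonBy α f` for every formal
coordinate change `φ` (zero constant terms, invertible linear part). -/
theorem wonBy_subst_iff {α : Ordinal.{0}} {n : ℕ} {φ : Fin n → MvPowerSeries (Fin n) k}
    (hφ0 : ∀ i, MvPowerSeries.constantCoeff (φ i) = 0) (hφdet : IsUnit (FormalCoordChange.linMat φ).det)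
    (f : MvPowerSeries (Fin n) k) :
    WonBy k α n (MvPowerSeries.subst φ f) ↔ WonBy k α n f := by
  refine ⟨wonBy_of_wonBy_subst hφ0 hφdet, fun h => ?_⟩
  obtain ⟨ψ, hψ0, hψφ, -⟩ := FormalCoordChange.exists_comp_inverse hφ0 hφdet
  refine wonBy_of_wonBy_subst hψ0 (isUnit_det_linMat_of_comp_eq_X hψ0 hψφ) ?_
  rwa [subst_subst_of_comp_eq_X hφ0 hψ0 hψφ f]

/-- COORDINATE INVARIANCE of the winning region: `Won (φ^* f) ↔ Won f`. -/
theorem won_subst_iff {n : ℕ} {φ : Fin n → MvPowerSeries (Fin n) k}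
    (hφ0 : ∀ i, MvPowerSeries.constantCoeff (φ i) = 0) (hφdet : IsUnit (FormalCoordChange.linMat φ).det)
    (f : MvPowerSeries (Fin n) k) :
    Won k n (MvPowerSeries.subst φ f) ↔ Won k n f := by
  rw [won_iff_exists_wonBy, won_iff_exists_wonBy]
  exact exists_congr fun α => wonBy_subst_iff hφ0 hφdet f

/-- COORDINATE INVARIANCE of the least game rank: `leastRank (φ^* f) = leastRank f`. -/
theorem leastRank_subst {n : ℕ} {φ : Fin n → MvPowerSeries (Fin n) k}
    (hφ0 : ∀ i, MvPowerSeries.constantCoeff (φ i) = 0) (hφdet : IsUnit (FormalCoordChange.linMat φ).det)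
    (f : MvPowerSeries (Fin n) k) :
    leastRank n (MvPowerSeries.subst φ f) = leastRank n f := by
  unfold leastRank
  congr 1
  ext α
  exact wonBy_subst_iff hφ0 hφdet f

/-! ### 3. Successors under multiplication by a unit -/

/-- The components of the crux's chart have zero constant terms. -/
theorem constantCoeff_cruxChart {n : ℕ} (w : Fin n → ℕ) (c : Fin n → k) (i : Fin n) :
    MvPowerSeries.constantCoeff (cruxChart k w c i) = 0 := by
  unfold cruxChart
  split_ifs with h
  · simp [MvPowerSeries.constantCoeff_X, zero_pow (Nat.pos_iff_ne_zero.mp h)]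
  · simp [MvPowerSeries.constantCoeff_X]

/-- A unit multiple of a germ in `𝔪²` is in `𝔪²`. -/
theorem singular_unit_mul {m : ℕ} (v g : MvPowerSeries (Fin m) k)
    (hg : MvPowerSeries.constantCoeff g = 0 ∧ ∀ j, MvPowerSeries.coeff (Finsupp.single j 1) g = 0) :
    MvPowerSeries.constantCoeff (v * g) = 0 ∧ ∀ j, MvPowerSeries.coeff (Finsupp.single j 1) (v * g) = 0 := by
  rw [← FormalCoordChange.two_le_order_iff] at hg ⊢
  exact hg.trans (le_trans le_add_self MvPowerSeries.le_order_mul)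

/-- UNIT FACTORS: a singular successor `g` of `u · f` (`u(0) ≠ 0`) under `(θ, w)` gives the singular
successor `U⁻¹ · g` of `f` under the same move at the same exceptional point, where
`U = (θ, chart)`-transform of `u` is a unit of `k[[s, y]]`. -/
theorem isSuccessor_of_isSuccessor_unit_mul {n : ℕ} {f u : MvPowerSeries (Fin n) k}
    (hu : MvPowerSeries.constantCoeff u ≠ 0) {θ : Fin n → MvPowerSeries (Fin n) k} {w : Fin n → ℕ}
    (hθ0 : ∀ i, MvPowerSeries.constantCoeff (θ i) = 0) {g : MvPowerSeries (Fin (n + 1)) k}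
    (hg : IsSuccessor k (u * f) θ w g) :
    ∃ v : MvPowerSeries (Fin (n + 1)) k, MvPowerSeries.constantCoeff v ≠ 0 ∧ IsSuccessor k f θ w (v * g) := by
  obtain ⟨c, a, hc, hfac, hndvd, hsing⟩ := hg
  have hθs := MvPowerSeries.hasSubst_of_constantCoeff_zero hθ0
  have hcs := MvPowerSeries.hasSubst_of_constantCoeff_zero (constantCoeff_cruxChart (k := k) w c)
  set U : MvPowerSeries (Fin (n + 1)) k :=
    MvPowerSeries.subst (cruxChart k w c) (MvPowerSeries.subst θ u) with hUdef
  set F : MvPowerSeries (Fin (n + 1)) k :=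
    MvPowerSeries.subst (cruxChart k w c) (MvPowerSeries.subst θ f) with hFdef
  have hU0 : MvPowerSeries.constantCoeff U = MvPowerSeries.constantCoeff u := by
    rw [hUdef, constantCoeff_subst_of_constantCoeff_zero _ (constantCoeff_cruxChart w c),
      constantCoeff_subst_of_constantCoeff_zero _ hθ0]
  have hUne : MvPowerSeries.constantCoeff U ≠ 0 := by rwa [hU0]
  have hUinv : U⁻¹ * U = 1 := MvPowerSeries.inv_mul_cancel U hUne
  have hfac' : U * F = MvPowerSeries.X 0 ^ a * g := by
    rw [hUdef, hFdef, ← MvPowerSeries.subst_mul hcs, ← MvPowerSeries.subst_mul hθs]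
    exact hfac
  refine ⟨U⁻¹, ?_, c, a, hc, ?_, ?_, singular_unit_mul _ _ hsing⟩
  · rw [MvPowerSeries.constantCoeff_inv]
    exact inv_ne_zero hUne
  · change F = _
    calc F = U⁻¹ * (U * F) := by rw [← mul_assoc, hUinv, one_mul]
      _ = MvPowerSeries.X 0 ^ a * (U⁻¹ * g) := by rw [hfac']; ring
  · rintro hdvd
    apply hndvd
    have : g = U * (U⁻¹ * g) := by rw [← mul_assoc, MvPowerSeries.mul_inv_cancel U hUne, one_mul]
    rw [this]
    exact hdvd.mul_left U

/-- UNIT INVARIANCE of the game values, one direction: `WonBy α f → WonBy α (u · f)` for `u(0) ≠ 0`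
(transfinite induction on `α`: the successors of `u · f` are unit multiples of successors of `f`). -/
theorem wonBy_unit_mul {α : Ordinal.{0}} :
    ∀ {n : ℕ} {f u : MvPowerSeries (Fin n) k}, MvPowerSeries.constantCoeff u ≠ 0 →
      WonBy k α n f → WonBy k α n (u * f) := by
  induction α using WellFoundedLT.induction with
  | ind α ih =>
    intro n f u hu h
    rw [wonBy_iff] at h ⊢
    obtain ⟨θ, w, hm, hs⟩ := h
    refine ⟨θ, w, hm, fun g hg => ?_⟩
    obtain ⟨v, hv, hvg⟩ := isSuccessor_of_isSuccessor_unit_mul hu hm.1 hg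
    obtain ⟨β, hβ, hW⟩ := hs (v * g) hvg
    refine ⟨β, hβ, ?_⟩
    have hv' : MvPowerSeries.constantCoeff v⁻¹ ≠ 0 := by
      rw [MvPowerSeries.constantCoeff_inv]; exact inv_ne_zero hv
    have := ih β hβ hv' hW
    rwa [← mul_assoc, MvPowerSeries.inv_mul_cancel v hv, one_mul] at this

/-- UNIT INVARIANCE of the game values: `WonBy α (u · f) ↔ WonBy α f` for `u(0) ≠ 0`. -/
theorem wonBy_unit_mul_iff {α : Ordinal.{0}} {n : ℕ} {u : MvPowerSeries (Fin n) k}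
    (hu : MvPowerSeries.constantCoeff u ≠ 0) (f : MvPowerSeries (Fin n) k) :
    WonBy k α n (u * f) ↔ WonBy k α n f := by
  refine ⟨fun h => ?_, wonBy_unit_mul hu⟩
  have hu' : MvPowerSeries.constantCoeff u⁻¹ ≠ 0 := by
    rw [MvPowerSeries.constantCoeff_inv]; exact inv_ne_zero hu
  have := wonBy_unit_mul hu' h
  rwa [← mul_assoc, MvPowerSeries.inv_mul_cancel u hu, one_mul] at this

/-- UNIT INVARIANCE of the winning region: `Won (u · f) ↔ Won f` for `u(0) ≠ 0`. -/
theorem won_unit_mul_iff {n : ℕ} {u : MvPowerSeries (Fin n) k}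
    (hu : MvPowerSeries.constantCoeff u ≠ 0) (f : MvPowerSeries (Fin n) k) :
    Won k n (u * f) ↔ Won k n f := by
  rw [won_iff_exists_wonBy, won_iff_exists_wonBy]
  exact exists_congr fun α => wonBy_unit_mul_iff hu f

/-- UNIT INVARIANCE of the least game rank: `leastRank (u · f) = leastRank f` for `u(0) ≠ 0`. -/
theorem leastRank_unit_mul {n : ℕ} {u : MvPowerSeries (Fin n) k}
    (hu : MvPowerSeries.constantCoeff u ≠ 0) (f : MvPowerSeries (Fin n) k) :
    leastRank n (u * f) = leastRank n f := by
  unfold leastRank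
  congr 1
  ext α
  exact wonBy_unit_mul_iff hu f

/-- THE GAME RANK IS AN INVARIANT OF THE IDEAL UP TO FORMAL COORDINATE CHANGE:
`leastRank (u · φ^* f) = leastRank f` for every unit `u` and formal coordinate change `φ`
(step (1) CANONIZE of the item: "invariant under formal automorphisms and units"). -/
theorem leastRank_unit_mul_subst {n : ℕ} {u : MvPowerSeries (Fin n) k} {φ : Fin n → MvPowerSeries (Fin n) k}
    (hu : MvPowerSeries.constantCoeff u ≠ 0) (hφ0 : ∀ i, MvPowerSeries.constantCoeff (φ i) = 0)
    (hφdet : IsUnit (FormalCoordChange.linMat φ).det) (f : MvPowerSeries (Fin n) k) :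
    leastRank n (u * MvPowerSeries.subst φ f) = leastRank n f := by
  rw [leastRank_unit_mul hu, leastRank_subst hφ0 hφdet]

/-! ### 4. The crux in inductive form and its canonical rank -/

/-- `LocalWeightedDrop` ⟺ over every algebraically closed field of characteristic `p` (every prime `p`)
every singular germ is in the inductive winning region of the local weighted resolution game. -/
theorem localWeightedDrop_iff_allWon :
    LocalWeightedDrop ↔ ∀ p : ℕ, p.Prime → ∀ (k : Type) [Field k] [CharP k p] [IsAlgClosed k],
      ∀ (n : ℕ) (f : MvPowerSeries (Fin n) k), IsSingular k f → Won k n f := by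
  constructor
  · intro h p hp k _ _ _
    exact (hasRank_iff_allWon (k := k)).mp ((hasRank_iff_literal (k := k)).mpr (h p hp k))
  · intro h p hp k _ _ _
    exact (hasRank_iff_literal (k := k)).mp ((hasRank_iff_allWon (k := k)).mpr (h p hp k))

/-- CANONICAL RANK: under `LocalWeightedDrop`, the least game rank `leastRank` (a definite function of
the bare series, no choices) has the crux's drop property at every singular germ. -/
theorem leastRank_drop_of_localWeightedDrop (hL : LocalWeightedDrop) {p : ℕ} (hp : p.Prime)
    (k : Type) [Field k] [CharP k p] [IsAlgClosed k] {n : ℕ} (f : MvPowerSeries (Fin n) k)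
    (hf : IsSingular k f) :
    ∃ (θ : Fin n → MvPowerSeries (Fin n) k) (w : Fin n → ℕ), IsMove k θ w ∧
      ∀ g, IsSuccessor k f θ w g → leastRank (n + 1) g < leastRank n f := by
  have hW := wonBy_leastRank (localWeightedDrop_iff_allWon.mp hL p hp k n f hf)
  rw [wonBy_iff] at hW
  obtain ⟨θ, w, hm, hs⟩ := hW
  refine ⟨θ, w, hm, fun g hg => ?_⟩
  obtain ⟨β, hβ, hWg⟩ := hs g hg
  exact lt_of_le_of_lt (leastRank_le hWg) hβ

/-- STEP (1) CANONIZE, assembled: `LocalWeightedDrop` holds iff, over every algebraically closed field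
of characteristic `p`, the canonical rank `leastRank` — which is invariant under units and formal
coordinate changes (`leastRank_unit_mul_subst`) — has the drop property at every singular germ. -/
theorem localWeightedDrop_iff_leastRank_drop :
    LocalWeightedDrop ↔ ∀ p : ℕ, p.Prime → ∀ (k : Type) [Field k] [CharP k p] [IsAlgClosed k],
      ∀ (n : ℕ) (f : MvPowerSeries (Fin n) k), IsSingular k f →
        ∃ (θ : Fin n → MvPowerSeries (Fin n) k) (w : Fin n → ℕ), IsMove k θ w ∧
          ∀ g, IsSuccessor k f θ w g → leastRank (n + 1) g < leastRank n f := by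
  refine ⟨fun hL p hp k _ _ _ n f hf => leastRank_drop_of_localWeightedDrop hL hp k f hf, fun h => ?_⟩
  rw [localWeightedDrop_iff_allWon]
  intro p hp k _ _ _
  exact won_of_rank ⟨leastRank, h p hp k⟩

end Summit.ResolutionOfSingularities.ResolutionOfSingularities.Theorems
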